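import Summits.AnomalousDissipation.AnomalousDissipation.Theorems.SolenoidalFractalHomogenisationLagrangianStepFrameChainRuleAEFrame
import Summits.AnomalousDissipation.AnomalousDissipation.Theorems.SolenoidalFractalHomogenisationLagrangianStepFrameBackwardLipschitz
import Summits.AnomalousDissipation.AnomalousDissipation.Theorems.SolenoidalFractalHomogenisationLagrangianStepFrameConjugacyAssembly
import Summits.AnomalousDissipation.AnomalousDissipation.Theorems.SolenoidalFractalHomogenisationLagrangianStepFrameContinuity
import Literature.Analysis.FluidPDE.PassiveVectorTensorLipschitzTest
import Literature.Analysis.FluidPDE.SolenoidalL2Duality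
import HarnessLib

/-!
# K1L_D (stmt-AnomalousDissipation-27980), v2 road (memo L22 §4) step (4): EULERIAN ⇒ FRAME for weak solutions — the CONVERSE of (C6)
# `FrameConj.isWeakTensorPassiveVectorDistortedOn_of_eulerian` (helper, `--supports 27980 --as helper`; prover lead-k1l-onelevel-p1 g7)

Piece `[w, t]` of a closed refresh window (`w = jR ≤ t ≤ jR + R`), cell clock `a = a (m+1)`, base `σ₁ ∈ [0, a(t−w))`, horizon `T = a(t−w) − σ₁`,
flow times `t′(τ) = w + (σ₁+τ)/a`.  GIVEN an Eulerian (flat) weak solution `u` on `(0,T)` along a continuous, weakly solenoidal cell-time carrier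
`Bt` from an `L²` datum `φE`, and a frame carrier `bc` (continuous, flat divergence free) with the POINTWISE RELATION
`∇X · bc(σ₁+τ) = (Bt τ − (1/a) b_{≤m}(t′)) ∘ X` on `(0,T)` (as in (C6): for the true member `IsInserted`, for the coarse member `bc = 0`), the
FRAME READING `wf τ y := u τ (X m (t′ τ) w y)` is a DISTORTED weak solution along the clamped frame curve from the datum `φE ∘ X m (t′ 0) w`.
The weak identity is transferred test by test in the direction opposite to (C6): an admissible distorted test `Ψ` is read as the Eulerian test
`Φ τ x := Ψ τ (X m w (t′♭ τ) x)` (BACKWARD map, clamped clock), which is an `IsLipschitzSpaceTimeTest` by the v2-road files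
(`SmoothFamily.comp_backward_frame` — all iterated space derivatives, `exists_lipschitz_comp_backward` — time-Lipschitz) and divergence free by the
closed-window Piola `isDivFree_distort_frameG_iff_closed`; the flat identity for Lipschitz tests (`weak_eq_of_isLipschitzSpaceTimeTest`, p-landed) is
then read through the volume-preserving forward maps: the time derivatives match for a.e. `(τ, y)` by `ae_ae_timeDeriv_comp_forward` (K3b), the
transport terms by `convect_comp_X` + the relation, the viscous terms by `viscAdjVar_conj_frameG_closed`, the data by substitution.
This is the `exists_sol` input of the v2 propagator spec (tenure RULING D28-10 (c)); the spec amendment itself is the next (S) step.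
No sorry, no definition, no named fact.  NOT a proof of `stub_Vmod_EHTthg`, of K1L_D or AD; rung F-D1.A0.
-/

set_option linter.dupNamespace false

noncomputable section

namespace Summit.AnomalousDissipation.AnomalousDissipation.Theorems.SolenoidalFractalHomogenisation.LagrangianStep.FrameConj

open Set Function Filter MeasureTheory Topology
open scoped NNReal ENNReal InnerProductSpace ContDiff
open Literature.Analysis Literature.Analysis.FunctionSpaces Literature.Analysis.FunctionSpaces.Torus
open Literature.Analysis.FluidPDE Literature.Analysis.FluidPDE.LatticeShear
open Literature.Analysis.FluidPDE.LatticeShear (LagrangianLatticeCarrier)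

variable {k : ℕ}

/-- An `IsLipschitzSpaceTimeTest` is a `SmoothFamily`. -/
theorem smoothFamily_of_isLipschitzSpaceTimeTest {F : Type*} [NormedAddCommGroup F] [NormedSpace ℝ F] {T : ℝ}
    {Ψ : ℝ → UnitAddTorus (Fin 3) → F} (hΨ : FluidPDE.Torus.IsLipschitzSpaceTimeTest T Ψ) : SmoothFamily Ψ :=
  ⟨hΨ.isSmooth_slice, hΨ.continuous_uncurry_iterPartialDeriv⟩

/-- Weak solenoidality of an `L²` field passes to its distortion-by-the-frame of the forward reading:
`∇·v = 0` weakly ⇒ `∇·(frameG (s+σ/a) s · (v ∘ X m (s+σ/a) s)) = 0` weakly ((L1) read backwards). -/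
theorem isWeaklyDivFree_distort_read (E : LagrangianLatticeCarrier k) (hR : E.LevelRegular) (m : ℕ) (s σ : ℝ)
    {v : UnitAddTorus (Fin 3) → EuclideanSpace ℝ (Fin 3)} (hv : MemLp v 2 volume) (hdiv : Torus.IsWeaklyDivFree v) :
    Torus.IsWeaklyDivFree (FluidPDE.Torus.distort (frameG E m (s + σ / E.a (m + 1)) s) (fun y => v (E.X m (s + σ / E.a (m + 1)) s y))) := by
  set U : V2 := hv.toLp v with hU
  have hUv : (⇑U : VF) =ᵐ[volume] v := hv.coeFn_toLp
  have hUdiv : Torus.IsWeaklyDivFree (⇑U : VF) := hdiv.congr_ae hUv.symm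
  have h := (isWeaklyDivFree_distort_frameRead_iff' E hR m s σ U).2 hUdiv
  -- `frameRead σ U = U ∘ X = v ∘ X` a.e.; distortion preserves a.e. equality
  have hread : (⇑(frameRead E hR m s σ U) : VF) =ᵐ[volume] fun y => v (E.X m (s + σ / E.a (m + 1)) s y) := by
    have h1 := frameRead_coeFn E hR m s σ U
    have h2 : (fun y => (U : VF) (E.X m (s + σ / E.a (m + 1)) s y)) =ᵐ[volume] fun y => v (E.X m (s + σ / E.a (m + 1)) s y) :=
      (hR.measurePreserving_X m (s + σ / E.a (m + 1)) s).quasiMeasurePreserving.ae_eq_comp hUv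
    exact h1.trans h2
  refine h.congr_ae ?_
  filter_upwards [hread] with y hy
  simp only [FluidPDE.Torus.distort, hy]

/-- Reparametrising the time of a smooth family by a continuous clock. -/
theorem SmoothFamily.comp_time {F : Type*} [NormedAddCommGroup F] [NormedSpace ℝ F] {f : ℝ → UnitAddTorus (Fin 3) → F}
    (hf : SmoothFamily f) {g : ℝ → ℝ} (hg : Continuous g) : SmoothFamily (fun τ => f (g τ)) :=
  ⟨fun τ => hf.1 (g τ), fun l => (hf.2 l).comp ((hg.comp continuous_fst).prodMk continuous_snd)⟩

/-- All-orders regularity of the backward reading along the SHIFTED clamped clock `σ₁ + τ` (`SmoothFamily.comp_backward` with the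
entries `smoothFamily_frameG_clamped` reparametrised by `SmoothFamily.comp_time`). -/
theorem SmoothFamily.comp_backward_frame_shift {F : Type*} [NormedAddCommGroup F] [NormedSpace ℝ F]
    (E : LagrangianLatticeCarrier k) (hR : E.LevelRegular) {m : ℕ} (hF : E.IsFlow m) (j : ℤ) {t : ℝ} (σ₁ : ℝ)
    (hjt : (j : ℝ) * E.refresh (m + 1) ≤ t) (htR : t ≤ (j : ℝ) * E.refresh (m + 1) + E.refresh (m + 1))
    {Ψ : ℝ → UnitAddTorus (Fin 3) → F} (hΨ : SmoothFamily Ψ) :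
    SmoothFamily (fun τ x => Ψ τ (E.X m ((j : ℝ) * E.refresh (m + 1)) ((j : ℝ) * E.refresh (m + 1)
      + max 0 (min (σ₁ + τ) (E.a (m + 1) * (t - (j : ℝ) * E.refresh (m + 1)))) / E.a (m + 1)) x)) := by
  have hclk : Continuous fun τ : ℝ => (j : ℝ) * E.refresh (m + 1)
      + max 0 (min (σ₁ + τ) (E.a (m + 1) * (t - (j : ℝ) * E.refresh (m + 1)))) / E.a (m + 1) :=
    continuous_const.add (((continuous_const.max ((continuous_const.add continuous_id).min continuous_const))).div_const _)
  exact SmoothFamily.comp_backward E hR m ((j : ℝ) * E.refresh (m + 1)) hclk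
    (fun c i => (smoothFamily_frameG_clamped E hR hF j hjt htR c i).comp_time (g := fun τ => σ₁ + τ)
      (continuous_const.add continuous_id)) hΨ

/-- **The backward reading of an admissible distorted test is an admissible FLAT Lipschitz test** (all iterated space derivatives by
`SmoothFamily.comp_backward_frame_shift`; time-Lipschitz by `exists_lipschitz_comp_backward`; support by inspection). -/
theorem isLipschitzSpaceTimeTest_comp_backward (E : LagrangianLatticeCarrier k) (hR : E.LevelRegular) {m : ℕ} (hF : E.IsFlow m) (j : ℤ)
    {t T : ℝ} (σ₁ : ℝ) (hjt : (j : ℝ) * E.refresh (m + 1) ≤ t) (htR : t ≤ (j : ℝ) * E.refresh (m + 1) + E.refresh (m + 1))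
    {Ψ : ℝ → UnitAddTorus (Fin 3) → EuclideanSpace ℝ (Fin 3)} (hΨ : FluidPDE.Torus.IsLipschitzSpaceTimeTest T Ψ) :
    FluidPDE.Torus.IsLipschitzSpaceTimeTest T (fun τ x => Ψ τ (E.X m ((j : ℝ) * E.refresh (m + 1)) ((j : ℝ) * E.refresh (m + 1)
      + max 0 (min (σ₁ + τ) (E.a (m + 1) * (t - (j : ℝ) * E.refresh (m + 1)))) / E.a (m + 1)) x)) := by
  have hSF := SmoothFamily.comp_backward_frame_shift E hR hF j σ₁ hjt htR (smoothFamily_of_isLipschitzSpaceTimeTest hΨ)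
  obtain ⟨LΦ, hLΦ0, hLΦ⟩ := exists_lipschitz_comp_backward E hR hF j σ₁ hjt htR hΨ
  obtain ⟨T', hT', hzero⟩ := hΨ.eventually_zero
  exact
  { isSmooth_slice := hSF.1
    continuous_uncurry := hSF.2 []
    continuous_uncurry_partialDeriv := fun i => hSF.2 [i]
    continuous_uncurry_partialDeriv₂ := fun i i' => hSF.2 [i, i']
    continuous_uncurry_iterPartialDeriv := hSF.2
    lipschitz := ⟨LΦ, hLΦ0, hLΦ⟩
    eventually_zero := ⟨T', hT', fun τ hτ => by funext x; simp only [hzero τ hτ]; rfl⟩ }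

/-- **EULERIAN ⇒ FRAME for weak solutions, cell time (converse of (C6)).**  See the module docstring. -/
theorem isWeakTensorPassiveVectorDistortedOn_of_eulerian (E : LagrangianLatticeCarrier k) (hR : E.LevelRegular) {m : ℕ} (hF : E.IsFlow m) (j : ℤ)
    {t σ₁ T : ℝ} (hjt : (j : ℝ) * E.refresh (m + 1) ≤ t) (htR : t ≤ (j : ℝ) * E.refresh (m + 1) + E.refresh (m + 1))
    (hσ₁ : 0 ≤ σ₁) (hσ₁T : σ₁ ≤ E.a (m + 1) * (t - (j : ℝ) * E.refresh (m + 1)))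
    (hT : T = E.a (m + 1) * (t - (j : ℝ) * E.refresh (m + 1)) - σ₁)
    {𝔸c : FluidPDE.Torus.Visc4 (Fin 3)} {bc Bt : ℝ → UnitAddTorus (Fin 3) → EuclideanSpace ℝ (Fin 3)}
    (hBt : Continuous (uncurry Bt)) (hbc : Continuous (uncurry bc)) (hbcdiv : ∀ σ, Torus.IsWeaklyDivFree (bc σ))
    (hRB : ∀ τ ∈ Ioo 0 T, ∀ y,
      E.flowDeriv m ((j : ℝ) * E.refresh (m + 1) + (σ₁ + τ) / E.a (m + 1)) ((j : ℝ) * E.refresh (m + 1)) y (bc (σ₁ + τ) y)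
        = Bt τ (E.X m ((j : ℝ) * E.refresh (m + 1) + (σ₁ + τ) / E.a (m + 1)) ((j : ℝ) * E.refresh (m + 1)) y)
          - (1 / E.a (m + 1)) • E.partialSum m ((j : ℝ) * E.refresh (m + 1) + (σ₁ + τ) / E.a (m + 1))
              (E.X m ((j : ℝ) * E.refresh (m + 1) + (σ₁ + τ) / E.a (m + 1)) ((j : ℝ) * E.refresh (m + 1)) y))
    {φE : UnitAddTorus (Fin 3) → EuclideanSpace ℝ (Fin 3)} (hφE : MemLp φE 2 volume)
    {u : ℝ → UnitAddTorus (Fin 3) → EuclideanSpace ℝ (Fin 3)}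
    (hu : FluidPDE.Torus.IsWeakTensorPassiveVectorOn 0 T 𝔸c Bt φE u) :
    FluidPDE.Torus.IsWeakTensorPassiveVectorDistortedOn 0 T 𝔸c (fun τ => bc (σ₁ + τ))
      (fun τ y => frameG E m ((j : ℝ) * E.refresh (m + 1) +
        max 0 (min (σ₁ + τ) (E.a (m + 1) * (t - (j : ℝ) * E.refresh (m + 1)))) / E.a (m + 1)) ((j : ℝ) * E.refresh (m + 1)) y)
      (fun y => φE (E.X m ((j : ℝ) * E.refresh (m + 1) + σ₁ / E.a (m + 1)) ((j : ℝ) * E.refresh (m + 1)) y))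
      (fun τ y => u τ (E.X m ((j : ℝ) * E.refresh (m + 1) + (σ₁ + τ) / E.a (m + 1)) ((j : ℝ) * E.refresh (m + 1)) y)) := by
  set w : ℝ := (j : ℝ) * E.refresh (m + 1) with hw
  have ha : 0 < E.a (m + 1) := E.a_pos (m + 1)
  have ha' : E.a (m + 1) ≠ 0 := ha.ne'
  have hθ : Continuous fun τ : ℝ => w + (σ₁ + τ) / E.a (m + 1) := by fun_prop
  have hXX : ∀ (t'' : ℝ) (y : UnitAddTorus (Fin 3)), E.X m w t'' (E.X m t'' w y) = y := fun t'' y => by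
    have h := congrFun (hR.X_comp_X m w t'' w) y
    rw [Function.comp_apply, hR.X_self m w] at h
    exact h
  have hXX' : ∀ (t'' : ℝ) (x : UnitAddTorus (Fin 3)), E.X m t'' w (E.X m w t'' x) = x := fun t'' x => by
    have h := congrFun (hR.X_comp_X m t'' w t'') x
    rw [Function.comp_apply, hR.X_self m t''] at h
    exact h
  -- bounds for the frame carrier on `[0,T] × 𝕋³`
  have hbcs : Continuous (uncurry fun (τ : ℝ) (y : UnitAddTorus (Fin 3)) => bc (σ₁ + τ) y) :=
    hbc.comp (((continuous_const.add continuous_fst)).prodMk continuous_snd)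
  obtain ⟨CB, hCB'⟩ := ((isCompact_Icc : IsCompact (Icc (0 : ℝ) T)).prod
    (isCompact_univ : IsCompact (univ : Set (UnitAddTorus (Fin 3))))).exists_bound_of_continuousOn hbcs.continuousOn
  have hCB : ∀ τ ∈ Icc (0 : ℝ) T, ∀ y, ‖bc (σ₁ + τ) y‖ ≤ CB := fun τ hτ y => hCB' (τ, y) (mk_mem_prod hτ (mem_univ _))
  obtain ⟨C, hC⟩ := hu.ae_lintegral_sq_le
  have hslice : ∀ᵐ τ ∂(volume.restrict (Ioo 0 T)), AEStronglyMeasurable (u τ) volume :=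
    hu.ae_aestronglyMeasurable_slice.mono fun τ h => h.1
  have hsq : ∀ᵐ τ ∂(volume.restrict (Ioo 0 T)), ∫⁻ y, ‖u τ (E.X m (w + (σ₁ + τ) / E.a (m + 1)) w y)‖ₑ ^ 2 ≤ C := by
    filter_upwards [hslice, hC] with τ hm hc
    rw [lintegral_comp_X E hR m (w + (σ₁ + τ) / E.a (m + 1)) w (f := fun y => ‖u τ y‖ₑ ^ 2) (hm.enorm.pow_const 2)]
    exact hc
  refine ⟨?_, ?_, ⟨C, hsq⟩, lintegral_carrier_lt_top_of_bound hCB, lintegral_mul_lt_top_of_bound hCB hsq,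
    Filter.Eventually.of_forall fun τ => hbcdiv (σ₁ + τ), ?_, ?_⟩
  · -- measurability of the forward reading
    refine aestronglyMeasurable_stLift_of_uncurry ?_
    have e : (uncurry fun τ y => u τ (E.X m (w + (σ₁ + τ) / E.a (m + 1)) w y))
        = uncurry u ∘ fun p : ℝ × UnitAddTorus (Fin 3) => (p.1, E.X m (w + (σ₁ + p.1) / E.a (m + 1)) w p.2) := by
      funext p; rfl
    rw [e]
    exact hu.aestronglyMeasurable_uncurry.comp_measurePreserving (measurePreserving_shear_forward E hR m w hθ (Ioo 0 T))
  · -- measurability of the carrier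
    have e : stLift (fun τ => bc (σ₁ + τ)) = (uncurry fun (τ : ℝ) (y : UnitAddTorus (Fin 3)) => bc (σ₁ + τ) y) ∘ Prod.map id proj := by
      funext p; rfl
    rw [e]
    exact (hbcs.comp (continuous_id.prodMap continuous_proj)).aestronglyMeasurable
  · -- a.e. distorted solenoidality of the reading
    filter_upwards [hu.ae_isWeaklyDivFree, hu.ae_memLp_two, ae_restrict_mem measurableSet_Ioo] with τ hdiv hm hτI
    have hcl := clamp_eq_of_mem_Ioo E m (r₀ := w) hσ₁ hT hτI
    simp only [hcl]
    exact isWeaklyDivFree_distort_read E hR m w (σ₁ + τ) hm hdiv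
  · -- THE WEAK IDENTITY
    intro Ψ hΨ hΨdiv
    -- the Eulerian test: the BACKWARD reading of `Ψ` along the clamped clock
    set Φ : ℝ → UnitAddTorus (Fin 3) → EuclideanSpace ℝ (Fin 3) :=
      fun τ x => Ψ τ (E.X m w (w + max 0 (min (σ₁ + τ) (E.a (m + 1) * (t - w))) / E.a (m + 1)) x) with hΦdef
    -- its admissibility
    have hΦtest : FluidPDE.Torus.IsLipschitzSpaceTimeTest T Φ := isLipschitzSpaceTimeTest_comp_backward E hR hF j σ₁ hjt htR hΨ
    have hSF : SmoothFamily Φ := smoothFamily_of_isLipschitzSpaceTimeTest hΦtest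
    obtain ⟨LΦ, hLΦ0, hLΦ⟩ := hΦtest.lipschitz
    -- divergence free: `Φ τ ∘ Xfwd(clamped) = Ψ τ`, closed-window Piola
    have hΦdiv : ∀ τ, Torus.IsDivFree (Φ τ) := by
      intro τ
      have hu' : max 0 (min (σ₁ + τ) (E.a (m + 1) * (t - w))) / E.a (m + 1) ∈ Icc 0 (t - w) := clamp_div_mem E m hjt _
      have h := (isDivFree_distort_frameG_iff_closed E hR hF j (T := t - w) (by linarith) hu' (hSF.1 τ)).1
      refine h ?_
      have e : (fun x => Φ τ (E.X m (w + max 0 (min (σ₁ + τ) (E.a (m + 1) * (t - w))) / E.a (m + 1)) w x)) = Ψ τ := by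
        funext y; simp only [hΦdef, hXX]
      rw [e]
      exact hΨdiv τ
    -- the flat identity for the Lipschitz test
    have hEul := hu.weak_eq_of_isLipschitzSpaceTimeTest hφE hΦtest hΦdiv
    simp only [zero_mul, add_zero] at hEul ⊢
    -- (ii) the datum terms agree
    have hdatum : ∫ x, ⟪φE x, Φ 0 x⟫_ℝ
        = ∫ y, ⟪φE (E.X m (w + σ₁ / E.a (m + 1)) w y), Ψ 0 y⟫_ℝ := by
      have hcl0 : max 0 (min (σ₁ + 0) (E.a (m + 1) * (t - w))) = σ₁ := by
        rw [add_zero, min_eq_left hσ₁T, max_eq_right hσ₁]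
      have hg : AEStronglyMeasurable (fun x => ⟪φE x, Φ 0 x⟫_ℝ) volume :=
        hφE.1.inner (hSF.1 0).continuous.aestronglyMeasurable
      rw [← integral_comp_X E hR m (w + σ₁ / E.a (m + 1)) w hg]
      refine integral_congr_ae (Filter.Eventually.of_forall fun y => ?_)
      simp only [hΦdef, hcl0, hXX]
    -- (i) the bulk terms agree for a.e. `τ`
    have hΦc : Continuous (uncurry Φ) := hSF.2 []
    have hK3 := ae_ae_timeDeriv_comp_forward E hR hF w σ₁ (T := T) (Φ := Φ) hΦc hSF.1
      (fun i => by simpa only [iterPartialDeriv_cons, iterPartialDeriv_nil] using hSF.2 [i]) ⟨LΦ, hLΦ0, hLΦ⟩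
    have hbulk : (fun τ => ∫ x, ⟪u τ x, Torus.timeDeriv Φ τ x + Torus.convect (Bt τ) (Φ τ) x + FluidPDE.Torus.viscAdj 𝔸c (Φ τ) x⟫_ℝ)
        =ᵐ[volume.restrict (Ioo 0 T)] fun τ => ∫ y, ⟪u τ (E.X m (w + (σ₁ + τ) / E.a (m + 1)) w y),
          Torus.timeDeriv Ψ τ y + Torus.convect (bc (σ₁ + τ)) (Ψ τ) y +
          FluidPDE.Torus.viscAdjVar (fun y => FluidPDE.Torus.Visc4.conj
            (frameG E m (w + max 0 (min (σ₁ + τ) (E.a (m + 1) * (t - w))) / E.a (m + 1)) w y) 𝔸c) (Ψ τ) y⟫_ℝ := by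
      filter_upwards [hslice, ae_restrict_mem measurableSet_Ioo, hK3] with τ huτ hτI hK3τ
      have hcl := clamp_eq_of_mem_Ioo E m (r₀ := w) hσ₁ hT hτI
      set t' : ℝ := w + (σ₁ + τ) / E.a (m + 1) with ht'
      have hu' : (σ₁ + τ) / E.a (m + 1) ∈ Icc 0 (t - w) := by
        refine ⟨div_nonneg (by linarith [hτI.1]) ha.le, ?_⟩
        rw [div_le_iff₀ ha]
        have h2 := hτI.2; rw [hT] at h2
        linarith [mul_comm (E.a (m + 1)) (t - w)]
      -- `Ψ τ = Φ τ ∘ Xfwd t'` (clamp inactive at `τ`)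
      have hΨΦ : Ψ τ = fun y => Φ τ (E.X m t' w y) := by
        funext y
        simp only [hΦdef, hcl]
        rw [← ht', hXX]
      -- measurability of the Eulerian integrand
      have hEi_meas : AEStronglyMeasurable (fun x => ⟪u τ x,
          Torus.timeDeriv Φ τ x + Torus.convect (Bt τ) (Φ τ) x + FluidPDE.Torus.viscAdj 𝔸c (Φ τ) x⟫_ℝ) volume := by
        refine huτ.inner ?_
        refine ((hΦtest.measurable_timeDeriv τ).aestronglyMeasurable.add (Continuous.aestronglyMeasurable ?_)).add
          (FluidPDE.Torus.isSmooth_viscAdj 𝔸c (hSF.1 τ)).continuous.aestronglyMeasurable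
        have hBτ : Continuous (Bt τ) := hBt.comp (continuous_const.prodMk continuous_id)
        have h : lift (Torus.convect (Bt τ) (Φ τ)) = fun y => fderiv ℝ (lift (Φ τ)) y (lift (Bt τ) y) := by
          funext y; rw [lift_apply, Torus.convect, ← fderiv_lift, lift_apply]
        rw [← continuous_lift_iff, h]
        exact ((hSF.1 τ).continuous_fderiv (by simp)).clm_apply (continuous_lift_iff.2 hBτ)
      rw [← integral_comp_X E hR m t' w hEi_meas]
      refine integral_congr_ae ?_
      filter_upwards [hK3τ] with y hy
      -- the time derivative of `Ψ` at `(τ, y)` along the forward flow (clamp inactive near `τ`)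
      have htd : Torus.timeDeriv Ψ τ y = Torus.timeDeriv Φ τ (E.X m t' w y)
          + (1 / E.a (m + 1)) • Torus.convect (E.partialSum m t') (Φ τ) (E.X m t' w y) := by
        rw [← hy]
        unfold Torus.timeDeriv
        refine Filter.EventuallyEq.deriv_eq ?_
        filter_upwards [Ioo_mem_nhds hτI.1 hτI.2] with s hs
        have hcls := clamp_eq_of_mem_Ioo E m (r₀ := w) hσ₁ hT hs
        simp only [hΦdef, hcls, hXX]
      -- the transport term through the frame
      have hcv : Torus.convect (bc (σ₁ + τ)) (Ψ τ) y = Torus.convect (Bt τ) (Φ τ) (E.X m t' w y)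
          - (1 / E.a (m + 1)) • Torus.convect (E.partialSum m t') (Φ τ) (E.X m t' w y) := by
        rw [hΨΦ, convect_comp_X E hR m t' w (hSF.1 τ) (bc (σ₁ + τ)) y, hRB τ hτI y, map_sub, map_smul]
        rfl
      -- the viscous term through the frame
      have hvs : FluidPDE.Torus.viscAdjVar (fun y => FluidPDE.Torus.Visc4.conj
            (frameG E m (w + max 0 (min (σ₁ + τ) (E.a (m + 1) * (t - w))) / E.a (m + 1)) w y) 𝔸c) (Ψ τ) y
          = FluidPDE.Torus.viscAdj 𝔸c (Φ τ) (E.X m t' w y) := by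
        rw [hcl, hΨΦ]
        exact viscAdjVar_conj_frameG_closed E hR hF j (T := t - w) (by linarith) hu' 𝔸c (hSF.1 τ) y
      rw [htd, hcv, hvs]
      congr 1
      abel
    rw [integral_congr_ae hbulk, hdatum] at hEul
    exact hEul

end Summit.AnomalousDissipation.AnomalousDissipation.Theorems.SolenoidalFractalHomogenisation.LagrangianStep.FrameConj

end
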